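import Literature.NumberTheory.Automorphic.GLnLeviOrbitalDescentCanonicalBochner
import Literature.NumberTheory.Automorphic.UnitaryGroupSplitPlaceOrbitalIntegral
import Literature.NumberTheory.Rogawski1990.LocalTransferSplitPlaceClasses
import Literature.NumberTheory.Automorphic.OrbitalIntegralCentralTransport
import Literature.NumberTheory.Automorphic.UnitaryGroupOrbitalMeasureOfLocalQuotient
import Literature.NumberTheory.Automorphic.CompactCoreLevelPoint
import Literature.NumberTheory.Automorphic.UnitaryGroupOfLocalCovolumeStable
import Literature.NumberTheory.Automorphic.UnitaryGroupOfLocalCovolumeStableKit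
import Literature.MeasureTheory.Group.ConjClassClosedEmbedding
import Literature.NumberTheory.Automorphic.ArchLocalRegularOrbitClosed
import HarnessLib

/-!
# The `G`-side of the smooth transfer at a split place: the class orbital integral of `φ ∈ C_c(U(J)(F_v))` at a regular class is
# `(C ‖det(1 − K_p)‖⁻¹ ‖det K_p‖) ×` the orbital integral ON THE LEVI `M` of the constant term of `φ ∘ e⁻¹` at the Levi point `p`, for EVERY
# canonically normalised torus measure (Rogawski (1990), Lemma 4.13.1 (a) p. 64, §4.9 p. 54)

Topic `NumberTheory/Rogawski1990`; namespace `Literature.NumberTheory.Rogawski1990`. THEOREMS ONLY (no definition, no instance, no notation, no named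
fact, no `sorry`). Cell `pub/hodgecm-mathlib`, programme P3a, road «D-N6s» (split-place clause of letter N6 ★ `LocalTransferExplicit`), brick **B5-R
«G-SIDE»** of the three-file assembly cut (LEAD T7-18), HYPOTHESIS-DRIVEN in the algebra of the Levi point (`hpM`, `hq`, `hTM`, `hp` — supplied by ★ B3
`LocalTransferSplitPlaceClasses`, ★ B4′ `GLnStandardLeviTwoBlockModel`, B4″), so valid for ANY rank `N`, monotone two-block labelling `c′`, hermitian `J`.
* §2 `exists_orbitalIntegral_eq_smul_orbitalIntegral_levi` — PURE `GL_N(E_w)`: ONE `C ∈ (0, ∞)` (★ B2 `exists_integral_descConj_quotientMeasure_eq_smul_integral_levi`)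
  with `O_p(φ′; ν′∕ρ_G) = (C ‖det(1 − K_p)‖⁻¹ ‖det K_p‖).toReal • O^M_p((φ′)^(P); ν_M∕ρ)` for every `p ∈ P ∩ M` with closed class, `C_GL(p) ≤ M`,
  `det(1 − K_p) ≠ 0`, all Haar inversion-invariant `ρ_G`, `ρ` with mass one on the compact cores, all `φ′ ∈ C_c` — (R5) descent at `T = C_GL(p)`
  (★ `integrable_descConj_of_isClosed`), (R6) the switch `(C(p) ⊓ M, t′) → (C_M(p), ρ′)` (★ `integral_descConj_quotientMeasure_eq_of_mulEquiv` at
  `refl`), (R7) `ρ′ = ρ` (★ `map_eq_of_apply_compactCore_eq_one'`, ★ `map_subgroupCongrHomeomorph_apply_compactCore`, §0).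
* §3 `exists_classOrbitalIntegral_eq_orbitalIntegral_of_split` — (R3) the canonical family read at `γ₀` (★ `IsCanonical.atPoint_eq_quotientMeasure`,
  ★ `orbitalIntegral_atPoint`), (R4) transport along `conj(q) ∘ e`, `e = localSplitEquiv` (★ `orbitalIntegral_quotientMeasure_eq_of_mulEquiv`,
  ★ `orbitalIntegral_conj_eq`, ★ `map_mulAutConj_eq_self`): `Φ([γ₀], φ; mG) = O_g(φ ∘ e⁻¹; e_*ν ∕ ρ_G)` with `ρ_G` of compact-core mass one;
  and the headline `exists_classOrbitalIntegral_eq_smul_orbitalIntegral_levi_of_split`: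
  `Φ([γ₀], φ; mG) = (C ‖det(1 − K_p)‖⁻¹ ‖det K_p‖).toReal • O^M_p((φ ∘ e⁻¹)^(P); ν_M ∕ ρ)`, `(ψ)^(P)(m) = ∫_{K×U} ψ(k (m u) k⁻¹) d(κ⊗μ_U)` inline.
NOT here: the `H`-side (B5-L), the transfer factor and `τ_v` (★ D-S2, B6), the test function (★ B1, B5-A), the algebraic binders (B4″).

## References
* [Rogawski1990] J. D. Rogawski, *Automorphic Representations of Unitary Groups in Three Variables*, Ann. of Math. Stud. 123 (1990), §4.13 Lemma
  4.13.1 (a) p. 64 and its proof pp. 64–66; §4.3 (4.3.1) p. 43; §4.9 p. 54.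
* [DeitmarEchterhoff2014] A. Deitmar, S. Echterhoff, *Principles of Harmonic Analysis*, 2nd ed. (2014), Thm. 1.5.3.
* [Mok2014] C. P. Mok, *Endoscopic classification of representations of quasi-split unitary groups*, Mem. AMS 235 (2015), §1 p. 5.
-/

set_option autoImplicit false

noncomputable section

open MeasureTheory Measure Set Filter Topology NumberField IsDedekindDomain Literature.MeasureTheory.Group
open scoped ENNReal NNReal Matrix MatrixGroups

namespace Literature.NumberTheory.Rogawski1990

open Literature.NumberTheory.Automorphic Literature.NumberTheory.Automorphic.UnitaryGroup
open Literature.NumberTheory.GaloisRepresentations.IsNonarchimedeanLocalField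

/-! ## §0 Two small transports -/

section Aux

variable {G : Type*} [Group G] [TopologicalSpace G] [IsTopologicalGroup G] [MeasurableSpace G] [BorelSpace G]
  {H L : Subgroup G} (hHL : H ≤ L)

omit [IsTopologicalGroup G] in
/-- The Haar measure transported along `H ≃ H ⊓ L` (`Subgroup.subgroupOfEquivOfLe`) gives the compact core the same mass (the map is an isomorphism of
topological groups, ★ `image_compactCore`). [cite: Rogawski1990, §4.3 (4.3.1) p. 43] -/
theorem map_subgroupOfEquivOfLe_symm_apply_compactCore (t : Measure ↥H) :
    Measure.map (Subgroup.subgroupOfEquivOfLe hHL).symm t (compactCore ↥(H.subgroupOf L)) = t (compactCore ↥H) := by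
  let eZ : ↥H ≃ₜ* ↥(H.subgroupOf L) :=
    { toMulEquiv := (Subgroup.subgroupOfEquivOfLe hHL).symm
      continuous_toFun := continuous_subgroupOfEquivOfLe_symm H L hHL
      continuous_invFun := continuous_subgroupOfEquivOfLe H L hHL }
  have heZ : ⇑((Subgroup.subgroupOfEquivOfLe hHL).symm) = ⇑(eZ.toHomeomorph.toMeasurableEquiv) := rfl
  rw [heZ, MeasurableEquiv.map_apply]
  have himg : ⇑(eZ.toHomeomorph.toMeasurableEquiv) ⁻¹' compactCore ↥(H.subgroupOf L) = compactCore ↥H := by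
    rw [← image_compactCore eZ, Homeomorph.toMeasurableEquiv_coe]
    exact Set.preimage_image_eq _ eZ.injective
  rw [himg]

end Aux

/-! ## §1 The switch `(C(p) ⊓ M, t′) → (C_M(p), ρ)` on the Levi -/

section LeviSwitch

variable {G : Type*} [Group G] [TopologicalSpace G] [IsTopologicalGroup G] [LocallyCompactSpace G] [SecondCountableTopology G] [T2Space G]
  [MeasurableSpace G] [BorelSpace G] (M : Subgroup G) [hMc : IsClosed (M : Set G)] [LocallyCompactSpace ↥M]
  [∀ m : ↥M, MeasurableSpace (↥M ⧸ Subgroup.centralizer ({m} : Set ↥M))] [∀ m : ↥M, BorelSpace (↥M ⧸ Subgroup.centralizer ({m} : Set ↥M))]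
  (νM : Measure ↥M) [IsHaarMeasure νM] [νM.IsMulRightInvariant]

omit [LocallyCompactSpace G] hMc in
/-- **The switch on the Levi.** For `p ∈ M` with `C_G(p) ≤ M`, a Haar inversion-invariant `t` on `C_G(p)` with compact-core mass one, its transport `t′` to
`C_G(p) ⊓ M ≤ M`, and ANY Haar inversion-invariant `ρ` on `C_M(p)` with compact-core mass one: the `M ⧸ (C_G(p) ⊓ M)`-integral of an orbital integrand
against `ν_M ∕ t′` IS the orbital integral on `M` at `p` against `ν_M ∕ ρ` (`C_G(p) ⊓ M = C_M(p)` as subgroups of `M`; transport along `refl` ★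
`integral_descConj_quotientMeasure_eq_of_mulEquiv`; `ρ′ = ρ` by ★ `map_eq_of_apply_compactCore_eq_one'`). [cite: Rogawski1990, §4.3 (4.3.1) p. 43]
[cite: DeitmarEchterhoff2014, Thm. 1.5.3] -/
theorem integral_descConj_subgroupOf_centralizer_eq_orbitalIntegral (p : G) (hpM : p ∈ M)
    (hTM : Subgroup.centralizer ({p} : Set G) ≤ M)
    [MeasurableSpace (↥M ⧸ (Subgroup.centralizer ({p} : Set G)).subgroupOf M)] [BorelSpace (↥M ⧸ (Subgroup.centralizer ({p} : Set G)).subgroupOf M)]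
    (t : Measure ↥(Subgroup.centralizer ({p} : Set G))) (ht : t (compactCore ↥(Subgroup.centralizer ({p} : Set G))) = 1)
    (t' : Measure ↥((Subgroup.centralizer ({p} : Set G)).subgroupOf M)) [IsHaarMeasure t'] [t'.IsInvInvariant]
    (ht' : t' = Measure.map (Subgroup.subgroupOfEquivOfLe hTM).symm t)
    (hTp : ∀ s ∈ (Subgroup.centralizer ({p} : Set G)).subgroupOf M, s * (⟨p, hpM⟩ : ↥M) = ⟨p, hpM⟩ * s)
    (ρ : Measure ↥(Subgroup.centralizer ({(⟨p, hpM⟩ : ↥M)} : Set ↥M))) [IsHaarMeasure ρ] [ρ.IsInvInvariant]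
    (hρ : ρ (compactCore ↥(Subgroup.centralizer ({(⟨p, hpM⟩ : ↥M)} : Set ↥M))) = 1)
    {E : Type*} [NormedAddCommGroup E] [NormedSpace ℝ E] (Ψ : ↥M → E) :
    ∫ z, descConj (⟨p, hpM⟩ : ↥M) ((Subgroup.centralizer ({p} : Set G)).subgroupOf M) hTp Ψ z
        ∂(quotientMeasure ((Subgroup.centralizer ({p} : Set G)).subgroupOf M) t'
          (isClosed_subgroupOf _ M (isClosed_coe_centralizer_singleton p)) νM) =
      orbitalIntegral (⟨p, hpM⟩ : ↥M) Ψ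
        (quotientMeasure (Subgroup.centralizer ({(⟨p, hpM⟩ : ↥M)} : Set ↥M)) ρ (isClosed_coe_centralizer_singleton _) νM) := by
  haveI hTc : IsClosed ((Subgroup.centralizer ({p} : Set G) : Subgroup G) : Set G) := isClosed_coe_centralizer_singleton p
  haveI : SecondCountableTopology ↥M := TopologicalSpace.Subtype.secondCountableTopology _
  haveI : BorelSpace ↥M := Subtype.borelSpace _
  haveI hTMc : IsClosed (((Subgroup.centralizer ({p} : Set G)).subgroupOf M : Subgroup ↥M) : Set ↥M) :=
    isClosed_subgroupOf _ M hTc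
  haveI : LocallyCompactSpace ↥((Subgroup.centralizer ({p} : Set G)).subgroupOf M) := hTMc.isClosedEmbedding_subtypeVal.locallyCompactSpace
  haveI : SecondCountableTopology ↥((Subgroup.centralizer ({p} : Set G)).subgroupOf M) := TopologicalSpace.Subtype.secondCountableTopology _
  haveI hCc : IsClosed ((Subgroup.centralizer ({(⟨p, hpM⟩ : ↥M)} : Set ↥M) : Subgroup ↥M) : Set ↥M) :=
    isClosed_coe_centralizer_singleton _
  haveI : LocallyCompactSpace ↥(Subgroup.centralizer ({(⟨p, hpM⟩ : ↥M)} : Set ↥M)) := hCc.isClosedEmbedding_subtypeVal.locallyCompactSpace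
  haveI : SecondCountableTopology ↥(Subgroup.centralizer ({(⟨p, hpM⟩ : ↥M)} : Set ↥M)) := TopologicalSpace.Subtype.secondCountableTopology _
  haveI : SFinite t' := inferInstance
  haveI : SFinite ρ := inferInstance
  -- the two subgroups of `M` agree
  have hHH' : ∀ m : ↥M, (MulEquiv.refl ↥M) m ∈ Subgroup.centralizer ({(⟨p, hpM⟩ : ↥M)} : Set ↥M) ↔
      m ∈ (Subgroup.centralizer ({p} : Set G)).subgroupOf M := fun m => by
    rw [MulEquiv.refl_apply, Subgroup.mem_centralizer_singleton_iff, Subgroup.mem_subgroupOf, Subgroup.mem_centralizer_singleton_iff]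
    constructor
    · intro h
      have h' := congrArg Subtype.val h
      simpa only [Subgroup.coe_mul] using h'
    · intro h
      exact Subtype.ext (by simpa only [Subgroup.coe_mul] using h)
  -- the transport of `t′` to `C_M(p)` along `refl` IS `ρ` (two Haar measures with compact-core mass one)
  haveI : IsHaarMeasure (Measure.map (subgroupCongrHomeomorph (MulEquiv.refl ↥M) _ _ hHH' continuous_id continuous_id) t') :=
    isHaarMeasure_map_subgroupCongrHomeomorph (MulEquiv.refl ↥M) continuous_id continuous_id _ _ hHH' _
  have hρ'1 : Measure.map (subgroupCongrHomeomorph (MulEquiv.refl ↥M) _ _ hHH' continuous_id continuous_id) t' (compactCore _) = 1 := by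
    rw [map_subgroupCongrHomeomorph_apply_compactCore, ht', map_subgroupOfEquivOfLe_symm_apply_compactCore, ht]
  have hρeq : ρ = Measure.map (subgroupCongrHomeomorph (MulEquiv.refl ↥M) _ _ hHH' continuous_id continuous_id) t' := by
    have h := map_eq_of_apply_compactCore_eq_one' (ContinuousMulEquiv.refl _) _ ρ hρ'1 hρ
    simpa only [ContinuousMulEquiv.coe_refl, Measure.map_id] using h.symm
  have key := integral_descConj_quotientMeasure_eq_of_mulEquiv (MulEquiv.refl ↥M) continuous_id continuous_id
    ((Subgroup.centralizer ({p} : Set G)).subgroupOf M) (Subgroup.centralizer ({(⟨p, hpM⟩ : ↥M)} : Set ↥M)) hHH'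
    t' ρ νM νM hρeq (by simp only [MulEquiv.coe_refl, Measure.map_id])
    (γ := (⟨p, hpM⟩ : ↥M)) (γ' := (⟨p, hpM⟩ : ↥M)) rfl hTp (fun _ hg => Subgroup.mem_centralizer_singleton_iff.1 hg) Ψ
  rw [orbitalIntegral, key]
  rfl

end LeviSwitch

/-! ## §2 The Levi descent at a point of `P ∩ M` with canonical torus measures (pure `GL_N`) -/

section Split

variable {F E : Type} [Field F] [NumberField F] [Field E] [NumberField E] [Algebra F E] [Algebra.IsQuadraticExtension F E]
  (c : E ≃ₐ[F] E) (N : ℕ) (J : Matrix (Fin N) (Fin N) E) {v : HeightOneSpectrum (𝓞 F)}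
  (hc : c ≠ 1) (hJ : (J.map c)ᵀ = J) (w : PlacesOver E v) (hw : c • w.1 ≠ w.1) (hJw : IsUnit (placeForm J w.1))
  {c' : Fin N → Bool}
  [MeasurableSpace (w.1.adicCompletion E)] [BorelSpace (w.1.adicCompletion E)]
  [MeasurableSpace («local» E c N J v)] [BorelSpace («local» E c N J v)]
  [∀ γ : «local» E c N J v, MeasurableSpace (↥(«local» E c N J v) ⧸ Subgroup.centralizer ({γ} : Set («local» E c N J v)))]
  [∀ γ : «local» E c N J v, BorelSpace (↥(«local» E c N J v) ⧸ Subgroup.centralizer ({γ} : Set («local» E c N J v)))]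
  [MeasurableSpace (GL (Fin N) (w.1.adicCompletion E))] [BorelSpace (GL (Fin N) (w.1.adicCompletion E))]
  [LocallyCompactSpace (GL (Fin N) (w.1.adicCompletion E))] [SecondCountableTopology (GL (Fin N) (w.1.adicCompletion E))]
  [LocallyCompactSpace ↥(standardLeviGL (w.1.adicCompletion E) c')]
  [MeasurableSpace (GL (Fin N) (w.1.adicCompletion E) ⧸ standardLeviGL (w.1.adicCompletion E) c')]
  [BorelSpace (GL (Fin N) (w.1.adicCompletion E) ⧸ standardLeviGL (w.1.adicCompletion E) c')]
  [∀ m : ↥(standardLeviGL (w.1.adicCompletion E) c'), MeasurableSpace (↥(standardLeviGL (w.1.adicCompletion E) c') ⧸ Subgroup.centralizer ({m} : Set ↥(standardLeviGL (w.1.adicCompletion E) c')))]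
  [∀ m : ↥(standardLeviGL (w.1.adicCompletion E) c'), BorelSpace (↥(standardLeviGL (w.1.adicCompletion E) c') ⧸ Subgroup.centralizer ({m} : Set ↥(standardLeviGL (w.1.adicCompletion E) c')))]
  (ν : Measure («local» E c N J v)) [IsHaarMeasure ν] [ν.IsMulRightInvariant]
  (mG : OrbitalMeasureFamily («local» E c N J v))
  (νM : Measure ↥(standardLeviGL (w.1.adicCompletion E) c')) [IsHaarMeasure νM] [νM.IsMulRightInvariant] [νM.IsInvInvariant]
  (κ : Measure ↥(glInt N (w.1.adicCompletion E))) [IsHaarMeasure κ]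
  (μU : Measure ↥(unipotentRadicalGL (w.1.adicCompletion E) c')) [IsHaarMeasure μU] [SFinite μU]

omit [NumberField F] [Algebra.IsQuadraticExtension F E] in
/-- **LEVI DESCENT OF THE ORBITAL INTEGRAL AT A POINT OF `P ∩ M`, CANONICAL TORUS MEASURES** (the `GL_N` half of B5-R): for a Haar right-invariant
`ν′` on `GL_N(E_w)` there is ONE `C ∈ (0, ∞)` (★ B2 `exists_integral_descConj_quotientMeasure_eq_smul_integral_levi`) such that for every `p ∈ P ∩ M`
with closed conjugacy class, `C_GL(p) ≤ M`, `det(1 − K_p) ≠ 0`, every Haar inversion-invariant `ρ_G` on `C_GL(p)` and `ρ` on `C_M(p)` with mass one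
on the compact cores and every `φ′ ∈ C_c(GL_N(E_w))`:
`O_p(φ′; ν′∕ρ_G) = (C ‖det(1 − K_p)‖⁻¹ ‖det K_p‖).toReal • O^M_p((φ′)^(P); ν_M∕ρ)` — (R5) the descent ★ B2 at `T = C_GL(p)` (integrability ★
`integrable_descConj_of_isClosed`), then (R6)(R7) the switch ★ `integral_descConj_subgroupOf_centralizer_eq_orbitalIntegral`.
[cite: Rogawski1990, §4.13 Lemma 4.13.1 (a) pp. 64–66; §4.3 (4.3.1) p. 43] [cite: DeitmarEchterhoff2014, Thm. 1.5.3] -/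
theorem exists_orbitalIntegral_eq_smul_orbitalIntegral_levi (hc' : Monotone c')
    (ν' : Measure (GL (Fin N) (w.1.adicCompletion E))) [IsHaarMeasure ν'] [ν'.IsMulRightInvariant] :
    ∃ C : ℝ≥0∞, C ≠ 0 ∧ C ≠ ∞ ∧
      ∀ (p : standardParabolicGL (w.1.adicCompletion E) c')
        (hpM : (p : GL (Fin N) (w.1.adicCompletion E)) ∈ standardLeviGL (w.1.adicCompletion E) c')
        (_hO : IsClosed {g : GL (Fin N) (w.1.adicCompletion E) | ∃ y : GL (Fin N) (w.1.adicCompletion E), y * (p : GL (Fin N) (w.1.adicCompletion E)) * y⁻¹ = g})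
        (_hTM : Subgroup.centralizer ({(p : GL (Fin N) (w.1.adicCompletion E))} : Set (GL (Fin N) (w.1.adicCompletion E))) ≤ standardLeviGL (w.1.adicCompletion E) c')
        (_hp : (1 - Matrix.of
              fun q q' : {i : Fin N // c' i = false} × {j : Fin N // c' j = true} =>
                ((p : GL (Fin N) (w.1.adicCompletion E)) : Matrix (Fin N) (Fin N) (w.1.adicCompletion E)) q.1 q'.1 *
                  (((p⁻¹ : standardParabolicGL (w.1.adicCompletion E) c') : GL (Fin N) (w.1.adicCompletion E)) :
                    Matrix (Fin N) (Fin N) (w.1.adicCompletion E)) q'.2 q.2).det ≠ 0)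
        [MeasurableSpace (GL (Fin N) (w.1.adicCompletion E) ⧸ Subgroup.centralizer ({(p : GL (Fin N) (w.1.adicCompletion E))} : Set (GL (Fin N) (w.1.adicCompletion E))))] [BorelSpace (GL (Fin N) (w.1.adicCompletion E) ⧸ Subgroup.centralizer ({(p : GL (Fin N) (w.1.adicCompletion E))} : Set (GL (Fin N) (w.1.adicCompletion E))))]
        (ρG : Measure ↥(Subgroup.centralizer ({(p : GL (Fin N) (w.1.adicCompletion E))} : Set (GL (Fin N) (w.1.adicCompletion E))))) [IsHaarMeasure ρG] [ρG.IsInvInvariant]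
        (_hρG : ρG (compactCore ↥(Subgroup.centralizer ({(p : GL (Fin N) (w.1.adicCompletion E))} : Set (GL (Fin N) (w.1.adicCompletion E))))) = 1)
        (ρ : Measure ↥(Subgroup.centralizer ({(⟨(p : GL (Fin N) (w.1.adicCompletion E)), hpM⟩ : ↥(standardLeviGL (w.1.adicCompletion E) c'))} : Set ↥(standardLeviGL (w.1.adicCompletion E) c')))) [IsHaarMeasure ρ] [ρ.IsInvInvariant]
        (_hρ : ρ (compactCore ↥(Subgroup.centralizer ({(⟨(p : GL (Fin N) (w.1.adicCompletion E)), hpM⟩ : ↥(standardLeviGL (w.1.adicCompletion E) c'))} : Set ↥(standardLeviGL (w.1.adicCompletion E) c')))) = 1)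
        (φ' : GL (Fin N) (w.1.adicCompletion E) → ℂ) (_hφc : Continuous φ') (_hφs : HasCompactSupport φ'),
        orbitalIntegral (p : GL (Fin N) (w.1.adicCompletion E)) φ' (quotientMeasure (Subgroup.centralizer ({(p : GL (Fin N) (w.1.adicCompletion E))} : Set (GL (Fin N) (w.1.adicCompletion E)))) ρG (isClosed_coe_centralizer_singleton _) ν') =
          (C * ((normAbs (w.1.adicCompletion E) ((1 - Matrix.of
              fun q q' : {i : Fin N // c' i = false} × {j : Fin N // c' j = true} =>
                ((p : GL (Fin N) (w.1.adicCompletion E)) : Matrix (Fin N) (Fin N) (w.1.adicCompletion E)) q.1 q'.1 *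
                  (((p⁻¹ : standardParabolicGL (w.1.adicCompletion E) c') : GL (Fin N) (w.1.adicCompletion E)) :
                    Matrix (Fin N) (Fin N) (w.1.adicCompletion E)) q'.2 q.2).det)⁻¹ *
            normAbs (w.1.adicCompletion E) (Matrix.of
              fun q q' : {i : Fin N // c' i = false} × {j : Fin N // c' j = true} =>
                ((p : GL (Fin N) (w.1.adicCompletion E)) : Matrix (Fin N) (Fin N) (w.1.adicCompletion E)) q.1 q'.1 *
                  (((p⁻¹ : standardParabolicGL (w.1.adicCompletion E) c') : GL (Fin N) (w.1.adicCompletion E)) :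
                    Matrix (Fin N) (Fin N) (w.1.adicCompletion E)) q'.2 q.2).det : ℝ≥0) : ℝ≥0∞)).toReal •
          orbitalIntegral (⟨(p : GL (Fin N) (w.1.adicCompletion E)), hpM⟩ : ↥(standardLeviGL (w.1.adicCompletion E) c'))
            (fun m : ↥(standardLeviGL (w.1.adicCompletion E) c') =>
              ∫ q' : ↥(glInt N (w.1.adicCompletion E)) × ↥(unipotentRadicalGL (w.1.adicCompletion E) c'),
                φ' ((q'.1 : GL (Fin N) (w.1.adicCompletion E)) * ((m : GL (Fin N) (w.1.adicCompletion E)) * (q'.2 : GL (Fin N) (w.1.adicCompletion E))) * (q'.1 : GL (Fin N) (w.1.adicCompletion E))⁻¹) ∂(κ.prod μU))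
            (quotientMeasure (Subgroup.centralizer ({(⟨(p : GL (Fin N) (w.1.adicCompletion E)), hpM⟩ : ↥(standardLeviGL (w.1.adicCompletion E) c'))} : Set ↥(standardLeviGL (w.1.adicCompletion E) c'))) ρ (isClosed_coe_centralizer_singleton _) νM) := by
  haveI hMc : IsClosed ((standardLeviGL (w.1.adicCompletion E) c' : Subgroup (GL (Fin N) (w.1.adicCompletion E))) : Set (GL (Fin N) (w.1.adicCompletion E))) := isClosed_standardLeviGL (R := (w.1.adicCompletion E)) c'
  haveI : BorelSpace ↥(standardLeviGL (w.1.adicCompletion E) c') := Subtype.borelSpace _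
  obtain ⟨C, hC0, hCt, hdesc⟩ := exists_integral_descConj_quotientMeasure_eq_smul_integral_levi (w.1.adicCompletion E) hc'
    (M := standardLeviGL (w.1.adicCompletion E) c') rfl ν' νM (quotientMeasure (standardLeviGL (w.1.adicCompletion E) c') νM hMc ν') (quotientMeasure_ne_zero _ _ _ _) κ μU
  refine ⟨C, hC0, hCt, ?_⟩
  intro p hpM hO hTM hp _ _ ρG _ _ hρG1 ρ _ _ hρ φ' hφ'c hφ's
  have hpT : ∀ s ∈ Subgroup.centralizer ({(p : GL (Fin N) (w.1.adicCompletion E))} : Set (GL (Fin N) (w.1.adicCompletion E))), s * (p : GL (Fin N) (w.1.adicCompletion E)) = (p : GL (Fin N) (w.1.adicCompletion E)) * s := fun _ hg => Subgroup.mem_centralizer_singleton_iff.1 hg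
  haveI hTc : IsClosed (((Subgroup.centralizer ({(p : GL (Fin N) (w.1.adicCompletion E))} : Set (GL (Fin N) (w.1.adicCompletion E)))) : Subgroup (GL (Fin N) (w.1.adicCompletion E))) : Set (GL (Fin N) (w.1.adicCompletion E))) := isClosed_coe_centralizer_singleton _
  haveI : LocallyCompactSpace ↥(Subgroup.centralizer ({(p : GL (Fin N) (w.1.adicCompletion E))} : Set (GL (Fin N) (w.1.adicCompletion E)))) := hTc.isClosedEmbedding_subtypeVal.locallyCompactSpace
  letI : MeasurableSpace (↥(standardLeviGL (w.1.adicCompletion E) c') ⧸ (Subgroup.centralizer ({(p : GL (Fin N) (w.1.adicCompletion E))} : Set (GL (Fin N) (w.1.adicCompletion E)))).subgroupOf (standardLeviGL (w.1.adicCompletion E) c')) := borel _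
  haveI : BorelSpace (↥(standardLeviGL (w.1.adicCompletion E) c') ⧸ (Subgroup.centralizer ({(p : GL (Fin N) (w.1.adicCompletion E))} : Set (GL (Fin N) (w.1.adicCompletion E)))).subgroupOf (standardLeviGL (w.1.adicCompletion E) c')) := ⟨rfl⟩
  have hint : Integrable (descConj (p : GL (Fin N) (w.1.adicCompletion E)) (Subgroup.centralizer ({(p : GL (Fin N) (w.1.adicCompletion E))} : Set (GL (Fin N) (w.1.adicCompletion E)))) hpT φ') (quotientMeasure _ ρG (isClosed_coe_centralizer_singleton (p : GL (Fin N) (w.1.adicCompletion E))) ν') :=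
    integrable_descConj_of_isClosed _ hO hφ'c hφ's _
  haveI : IsHaarMeasure (Measure.map (Subgroup.subgroupOfEquivOfLe hTM).symm ρG) :=
    MulEquiv.isHaarMeasure_map ρG (Subgroup.subgroupOfEquivOfLe hTM).symm
      (continuous_subgroupOfEquivOfLe_symm _ _ hTM) (continuous_subgroupOfEquivOfLe _ _ hTM)
  haveI : (Measure.map (Subgroup.subgroupOfEquivOfLe hTM).symm ρG).IsInvInvariant :=
    isInvInvariant_map_mulEquiv (Subgroup.subgroupOfEquivOfLe hTM).symm (continuous_subgroupOfEquivOfLe_symm _ _ hTM).measurable ρG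
  haveI hTMc : IsClosed ((((Subgroup.centralizer ({(p : GL (Fin N) (w.1.adicCompletion E))} : Set (GL (Fin N) (w.1.adicCompletion E)))).subgroupOf (standardLeviGL (w.1.adicCompletion E) c')) : Subgroup ↥(standardLeviGL (w.1.adicCompletion E) c')) : Set ↥(standardLeviGL (w.1.adicCompletion E) c')) := isClosed_subgroupOf _ _ hTc
  haveI : LocallyCompactSpace ↥((Subgroup.centralizer ({(p : GL (Fin N) (w.1.adicCompletion E))} : Set (GL (Fin N) (w.1.adicCompletion E)))).subgroupOf (standardLeviGL (w.1.adicCompletion E) c')) := hTMc.isClosedEmbedding_subtypeVal.locallyCompactSpace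
  haveI : SFinite (Measure.map (Subgroup.subgroupOfEquivOfLe hTM).symm ρG) := inferInstance
  obtain ⟨-, hB⟩ := hdesc (Subgroup.centralizer ({(p : GL (Fin N) (w.1.adicCompletion E))} : Set (GL (Fin N) (w.1.adicCompletion E)))) (isClosed_coe_centralizer_singleton (p : GL (Fin N) (w.1.adicCompletion E))) hTM ρG
    (Measure.map (Subgroup.subgroupOfEquivOfLe hTM).symm ρG) rfl p hpM hpT hp φ' hφ'c hint
  have hSwitch := integral_descConj_subgroupOf_centralizer_eq_orbitalIntegral (standardLeviGL (w.1.adicCompletion E) c') νM (p : GL (Fin N) (w.1.adicCompletion E)) hpM hTM ρG hρG1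
    (Measure.map (Subgroup.subgroupOfEquivOfLe hTM).symm ρG) rfl (fun s hs => Subtype.ext (hpT (s : GL (Fin N) (w.1.adicCompletion E)) hs)) ρ hρ
    (fun m : ↥(standardLeviGL (w.1.adicCompletion E) c') =>
      ∫ q' : ↥(glInt N (w.1.adicCompletion E)) × ↥(unipotentRadicalGL (w.1.adicCompletion E) c'),
        φ' ((q'.1 : GL (Fin N) (w.1.adicCompletion E)) * ((m : GL (Fin N) (w.1.adicCompletion E)) * (q'.2 : GL (Fin N) (w.1.adicCompletion E))) * (q'.1 : GL (Fin N) (w.1.adicCompletion E))⁻¹) ∂(κ.prod μU))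
  rw [orbitalIntegral_eq_integral_descConj, hB, hSwitch]

/-! ## §3 The `G`-side at a split place -/

omit [MeasurableSpace (w.1.adicCompletion E)] [BorelSpace (w.1.adicCompletion E)] in
/-- **(R3)(R4) THE CLASS ORBITAL INTEGRAL OF A CANONICAL FAMILY, READ ON `GL_N(E_w)`**: for `γ₀` regular, `q (e γ₀) q⁻¹ = g` and `ν′ = e_* ν` there is a
Haar inversion-invariant `ρ_G` on `C_GL(g)` with mass one on the compact core (the transport of the canonical torus measure along `conj(q) ∘ e`) with
`Φ([γ₀], φ; mG) = O_g(φ ∘ e⁻¹; ν′∕ρ_G)` for every `φ` (★ `IsCanonical.atPoint_eq_quotientMeasure`, ★ `OrbitalMeasureFamily.orbitalIntegral_atPoint`,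
★ `orbitalIntegral_quotientMeasure_eq_of_mulEquiv`, ★ `orbitalIntegral_conj_eq`, ★ `map_mulAutConj_eq_self`, ★ `map_subgroupCongrHomeomorph_apply_compactCore`).
[cite: Rogawski1990, §4.3 (4.3.1) p. 43; §4.9 p. 54] [cite: DeitmarEchterhoff2014, Thm. 1.5.3] [cite: Mok2014, §1 Notation p. 5] -/
theorem exists_classOrbitalIntegral_eq_orbitalIntegral_of_split
    (hcanG : mG.IsCanonical (fun γ : «local» E c N J v => IsRegularElt (γ : GL (Fin N) (LocalRing E v))) ν)
    (ν' : Measure (GL (Fin N) (w.1.adicCompletion E))) [IsHaarMeasure ν'] [ν'.IsMulRightInvariant] (hν' : ν' = ν.map (localSplitEquiv c J hc hJ w hw hJw))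
    (γ₀ : «local» E c N J v) (hreg : IsRegularElt (γ₀ : GL (Fin N) (LocalRing E v))) (g q : GL (Fin N) (w.1.adicCompletion E))
    (hq : q * localSplitEquiv c J hc hJ w hw hJw γ₀ * q⁻¹ = g)
    [MeasurableSpace (GL (Fin N) (w.1.adicCompletion E) ⧸ Subgroup.centralizer ({g} : Set (GL (Fin N) (w.1.adicCompletion E))))] [BorelSpace (GL (Fin N) (w.1.adicCompletion E) ⧸ Subgroup.centralizer ({g} : Set (GL (Fin N) (w.1.adicCompletion E))))]
    (φ : «local» E c N J v → ℂ) :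
    ∃ ρG : Measure ↥(Subgroup.centralizer ({g} : Set (GL (Fin N) (w.1.adicCompletion E)))), ∃ (_ : IsHaarMeasure ρG) (_ : ρG.IsInvInvariant),
      ρG (compactCore ↥(Subgroup.centralizer ({g} : Set (GL (Fin N) (w.1.adicCompletion E))))) = 1 ∧
        classOrbitalIntegral mG φ (ConjClasses.mk γ₀) =
          orbitalIntegral g (φ ∘ ⇑(localSplitEquiv c J hc hJ w hw hJw).symm)
            (quotientMeasure (Subgroup.centralizer ({g} : Set (GL (Fin N) (w.1.adicCompletion E)))) ρG (isClosed_coe_centralizer_singleton g) ν') := by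
  haveI hTc : IsClosed ((Subgroup.centralizer ({g} : Set (GL (Fin N) (w.1.adicCompletion E))) : Subgroup (GL (Fin N) (w.1.adicCompletion E))) : Set (GL (Fin N) (w.1.adicCompletion E))) := isClosed_coe_centralizer_singleton _
  haveI : LocallyCompactSpace ↥(Subgroup.centralizer ({g} : Set (GL (Fin N) (w.1.adicCompletion E)))) := hTc.isClosedEmbedding_subtypeVal.locallyCompactSpace
  haveI hC0c : IsClosed ((Subgroup.centralizer ({γ₀} : Set («local» E c N J v)) : Subgroup («local» E c N J v)) : Set («local» E c N J v)) :=
    isClosed_coe_centralizer_singleton _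
  haveI : LocallyCompactSpace ↥(Subgroup.centralizer ({γ₀} : Set («local» E c N J v))) := hC0c.isClosedEmbedding_subtypeVal.locallyCompactSpace
  -- (R3) the canonical family read at `γ₀`
  have hout : IsRegularElt ((Quotient.out (ConjClasses.mk γ₀) : «local» E c N J v) : GL (Fin N) (LocalRing E v)) := by
    obtain ⟨x, hx⟩ := isConj_iff.1 (ConjClasses.mk_eq_mk_iff_isConj.1 (Quotient.out_eq (ConjClasses.mk γ₀)))
    have hx' : (x : GL (Fin N) (LocalRing E v)) * ((Quotient.out (ConjClasses.mk γ₀) : «local» E c N J v) : GL (Fin N) (LocalRing E v)) *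
        (x : GL (Fin N) (LocalRing E v))⁻¹ = (γ₀ : GL (Fin N) (LocalRing E v)) := by
      rw [← Subgroup.coe_mul, ← Subgroup.coe_inv, ← Subgroup.coe_mul, hx]
    rw [← isRegularElt_conj_iff (x : GL (Fin N) (LocalRing E v)), hx']
    exact hreg
  obtain ⟨tG, htG, htGi, htG1, hat⟩ := hcanG.atPoint_eq_quotientMeasure γ₀ hout
  haveI := htG
  haveI := htGi
  haveI : SMulInvariantMeasure («local» E c N J v)
      (↥(«local» E c N J v) ⧸ Subgroup.centralizer ({(Quotient.out (ConjClasses.mk γ₀) : «local» E c N J v)} : Set («local» E c N J v)))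
      (mG (ConjClasses.mk γ₀)) := by
    obtain ⟨t0, ht0, ht0i, -, hmc⟩ := hcanG (ConjClasses.mk γ₀) hout
    haveI := ht0
    haveI := ht0i
    rw [hmc]
    exact smulInvariantMeasure_quotientMeasure _ _ _ _
  have h1 : classOrbitalIntegral mG φ (ConjClasses.mk γ₀) =
      orbitalIntegral γ₀ φ (quotientMeasure (Subgroup.centralizer ({γ₀} : Set («local» E c N J v))) tG
        (isClosed_coe_centralizer_singleton γ₀) ν) := by
    have h := (OrbitalMeasureFamily.orbitalIntegral_atPoint mG γ₀ φ).symm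
    rw [hat] at h
    exact h
  -- (R4) transport along `e₂ = conj(q) ∘ e`
  obtain ⟨e₂, he₂_def⟩ : ∃ e₂ : ↥(«local» E c N J v) ≃* GL (Fin N) (w.1.adicCompletion E), e₂ = (localSplitEquiv c J hc hJ w hw hJw).toMulEquiv.trans (MulAut.conj q) := ⟨_, rfl⟩
  have he₂ : Continuous e₂ := by
    refine ((continuous_mulAutConj q).comp (localSplitEquiv c J hc hJ w hw hJw).continuous).congr fun x => ?_
    rw [he₂_def, MulEquiv.trans_apply]
    rfl
  have hes₂ : Continuous e₂.symm := by
    refine ((localSplitEquiv c J hc hJ w hw hJw).symm.continuous.comp (continuous_mulAutConj_symm q)).congr fun x => ?_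
    rw [he₂_def, MulEquiv.symm_trans_apply]
    rfl
  have hγ₂ : e₂ γ₀ = g := by
    rw [← hq, he₂_def, MulEquiv.trans_apply, MulAut.conj_apply]
    rfl
  obtain ⟨ρG, hρG_def⟩ : ∃ ρG : Measure ↥(Subgroup.centralizer ({g} : Set (GL (Fin N) (w.1.adicCompletion E)))),
      ρG = Measure.map (subgroupCongrHomeomorph e₂ _ _ (forall_apply_mem_centralizer_singleton_iff_of_eq e₂ hγ₂) he₂ hes₂) tG := ⟨_, rfl⟩
  haveI hρG : IsHaarMeasure ρG := by rw [hρG_def]; exact isHaarMeasure_map_subgroupCongrHomeomorph _ _ _ _ _ _ tG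
  haveI hρGi : ρG.IsInvInvariant := by rw [hρG_def]; exact isInvInvariant_map_subgroupCongrHomeomorph _ _ _ _ _ _ tG
  refine ⟨ρG, hρG, hρGi, ?_, ?_⟩
  · rw [hρG_def, map_subgroupCongrHomeomorph_apply_compactCore]
    exact htG1
  have hme : Measurable (⇑(localSplitEquiv c J hc hJ w hw hJw) : «local» E c N J v → GL (Fin N) (w.1.adicCompletion E)) := (localSplitEquiv c J hc hJ w hw hJw).continuous.measurable
  have hν₂ : ν' = Measure.map e₂ ν := by
    have hce : (⇑e₂ : «local» E c N J v → GL (Fin N) (w.1.adicCompletion E)) = ⇑(MulAut.conj q : GL (Fin N) (w.1.adicCompletion E) ≃* GL (Fin N) (w.1.adicCompletion E)) ∘ ⇑(localSplitEquiv c J hc hJ w hw hJw) := by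
      funext x
      rw [he₂_def]
      rfl
    rw [hce, ← Measure.map_map (continuous_mulAutConj q).measurable hme, ← hν', map_mulAutConj_eq_self]
  have h2 := orbitalIntegral_quotientMeasure_eq_of_mulEquiv e₂ he₂ hes₂ hγ₂ (isClosed_coe_centralizer_singleton γ₀)
    (isClosed_coe_centralizer_singleton g) tG ρG ν ν' hρG_def hν₂ (φ ∘ ⇑(localSplitEquiv c J hc hJ w hw hJw).symm)
  have hcomp : (φ ∘ ⇑(localSplitEquiv c J hc hJ w hw hJw).symm) ∘ ⇑e₂ = φ ∘ ⇑(MulAut.conj ((localSplitEquiv c J hc hJ w hw hJw).symm q) : «local» E c N J v ≃* «local» E c N J v) := by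
    funext x
    rw [he₂_def]
    show φ ((localSplitEquiv c J hc hJ w hw hJw).symm (MulAut.conj q ((localSplitEquiv c J hc hJ w hw hJw) x))) = φ (MulAut.conj ((localSplitEquiv c J hc hJ w hw hJw).symm q) x)
    simp only [MulAut.conj_apply, map_mul, map_inv, ContinuousMulEquiv.symm_apply_apply]
  rw [hcomp, orbitalIntegral_conj_eq] at h2
  rw [h1, ← h2]

/-- **B5-R, THE `G`-SIDE OF THE SMOOTH TRANSFER AT A SPLIT PLACE.** ONE constant `C` for EVERY regular class `[γ₀]` of `U(J)(F_v)`, every admissible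
Levi point `p` over it (`q (e γ₀) q⁻¹ = p ∈ P ∩ M`, `C_GL(p) ≤ M`, `det(1 − K_p) ≠ 0`), every Haar inversion-invariant `ρ` on `C_M(p)` with mass one on
the compact core and every `φ ∈ C_c(U(J)(F_v))`:
`Φ([γ₀], φ; mG) = (C ‖det(1 − K_p)‖⁻¹ ‖det K_p‖).toReal • O^M_p((φ ∘ e⁻¹)^(P); ν_M ∕ ρ)` (§3 (R3)(R4), then §2 with `ν′ = e_* ν`; the class of `p` is
closed since `p` is regular semisimple, ★ `isRegularElt_localSplitEquiv_of_isRegularElt`, ★ `isClosed_conjClass_of_charpoly_separable_field`).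
[cite: Rogawski1990, §4.13 Lemma 4.13.1 (a) pp. 64–66; §4.3 (4.3.1) p. 43; §4.9 p. 54] [cite: DeitmarEchterhoff2014, Thm. 1.5.3] [cite: Mok2014, §1 Notation p. 5] -/
theorem exists_classOrbitalIntegral_eq_smul_orbitalIntegral_levi_of_split (hc' : Monotone c')
    (hcanG : mG.IsCanonical (fun γ : «local» E c N J v => IsRegularElt (γ : GL (Fin N) (LocalRing E v))) ν) :
    ∃ C : ℝ≥0∞, C ≠ 0 ∧ C ≠ ∞ ∧
      ∀ (γ₀ : «local» E c N J v) (_hreg : IsRegularElt (γ₀ : GL (Fin N) (LocalRing E v)))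
        (p : standardParabolicGL (w.1.adicCompletion E) c')
        (hpM : (p : GL (Fin N) (w.1.adicCompletion E)) ∈ standardLeviGL (w.1.adicCompletion E) c')
        (q : GL (Fin N) (w.1.adicCompletion E))
        (_hq : q * localSplitEquiv c J hc hJ w hw hJw γ₀ * q⁻¹ = (p : GL (Fin N) (w.1.adicCompletion E)))
        (_hTM : Subgroup.centralizer ({(p : GL (Fin N) (w.1.adicCompletion E))} : Set (GL (Fin N) (w.1.adicCompletion E))) ≤ standardLeviGL (w.1.adicCompletion E) c')
        (_hp : (1 - Matrix.of
              fun q q' : {i : Fin N // c' i = false} × {j : Fin N // c' j = true} =>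
                ((p : GL (Fin N) (w.1.adicCompletion E)) : Matrix (Fin N) (Fin N) (w.1.adicCompletion E)) q.1 q'.1 *
                  (((p⁻¹ : standardParabolicGL (w.1.adicCompletion E) c') : GL (Fin N) (w.1.adicCompletion E)) :
                    Matrix (Fin N) (Fin N) (w.1.adicCompletion E)) q'.2 q.2).det ≠ 0)
        (ρ : Measure ↥(Subgroup.centralizer ({(⟨(p : GL (Fin N) (w.1.adicCompletion E)), hpM⟩ : ↥(standardLeviGL (w.1.adicCompletion E) c'))} : Set ↥(standardLeviGL (w.1.adicCompletion E) c')))) [IsHaarMeasure ρ] [ρ.IsInvInvariant]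
        (_hρ : ρ (compactCore ↥(Subgroup.centralizer ({(⟨(p : GL (Fin N) (w.1.adicCompletion E)), hpM⟩ : ↥(standardLeviGL (w.1.adicCompletion E) c'))} : Set ↥(standardLeviGL (w.1.adicCompletion E) c')))) = 1)
        (φ : «local» E c N J v → ℂ) (_hφc : Continuous φ) (_hφs : HasCompactSupport φ),
        classOrbitalIntegral mG φ (ConjClasses.mk γ₀) =
          (C * ((normAbs (w.1.adicCompletion E) ((1 - Matrix.of
              fun q q' : {i : Fin N // c' i = false} × {j : Fin N // c' j = true} =>
                ((p : GL (Fin N) (w.1.adicCompletion E)) : Matrix (Fin N) (Fin N) (w.1.adicCompletion E)) q.1 q'.1 *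
                  (((p⁻¹ : standardParabolicGL (w.1.adicCompletion E) c') : GL (Fin N) (w.1.adicCompletion E)) :
                    Matrix (Fin N) (Fin N) (w.1.adicCompletion E)) q'.2 q.2).det)⁻¹ *
            normAbs (w.1.adicCompletion E) (Matrix.of
              fun q q' : {i : Fin N // c' i = false} × {j : Fin N // c' j = true} =>
                ((p : GL (Fin N) (w.1.adicCompletion E)) : Matrix (Fin N) (Fin N) (w.1.adicCompletion E)) q.1 q'.1 *
                  (((p⁻¹ : standardParabolicGL (w.1.adicCompletion E) c') : GL (Fin N) (w.1.adicCompletion E)) :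
                    Matrix (Fin N) (Fin N) (w.1.adicCompletion E)) q'.2 q.2).det : ℝ≥0) : ℝ≥0∞)).toReal •
          orbitalIntegral (⟨(p : GL (Fin N) (w.1.adicCompletion E)), hpM⟩ : ↥(standardLeviGL (w.1.adicCompletion E) c'))
            (fun m : ↥(standardLeviGL (w.1.adicCompletion E) c') =>
              ∫ q' : ↥(glInt N (w.1.adicCompletion E)) × ↥(unipotentRadicalGL (w.1.adicCompletion E) c'),
                φ ((localSplitEquiv c J hc hJ w hw hJw).symm
                  ((q'.1 : GL (Fin N) (w.1.adicCompletion E)) * ((m : GL (Fin N) (w.1.adicCompletion E)) *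
                    (q'.2 : GL (Fin N) (w.1.adicCompletion E))) * (q'.1 : GL (Fin N) (w.1.adicCompletion E))⁻¹)) ∂(κ.prod μU))
            (quotientMeasure (Subgroup.centralizer ({(⟨(p : GL (Fin N) (w.1.adicCompletion E)), hpM⟩ : ↥(standardLeviGL (w.1.adicCompletion E) c'))} : Set ↥(standardLeviGL (w.1.adicCompletion E) c'))) ρ (isClosed_coe_centralizer_singleton _) νM) := by
  haveI : IsHaarMeasure (ν.map (localSplitEquiv c J hc hJ w hw hJw)) := (localSplitEquiv c J hc hJ w hw hJw).isHaarMeasure_map ν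
  haveI : (ν.map (localSplitEquiv c J hc hJ w hw hJw)).IsMulRightInvariant :=
    isMulRightInvariant_map_mulEquiv_of_isMulRightInvariant (localSplitEquiv c J hc hJ w hw hJw).toMulEquiv (localSplitEquiv c J hc hJ w hw hJw).continuous.measurable ν
  obtain ⟨C, hC0, hCt, hB⟩ := exists_orbitalIntegral_eq_smul_orbitalIntegral_levi N w (c' := c') νM κ μU hc' (ν.map (localSplitEquiv c J hc hJ w hw hJw))
  refine ⟨C, hC0, hCt, ?_⟩
  intro γ₀ hreg p hpM q hq hTM hp ρ _ _ hρ φ hφc hφs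
  letI : MeasurableSpace (GL (Fin N) (w.1.adicCompletion E) ⧸ Subgroup.centralizer ({(p : GL (Fin N) (w.1.adicCompletion E))} : Set (GL (Fin N) (w.1.adicCompletion E)))) := borel _
  haveI : BorelSpace (GL (Fin N) (w.1.adicCompletion E) ⧸ Subgroup.centralizer ({(p : GL (Fin N) (w.1.adicCompletion E))} : Set (GL (Fin N) (w.1.adicCompletion E)))) := ⟨rfl⟩
  obtain ⟨ρG, hρG, hρGi, hρG1, hA⟩ := exists_classOrbitalIntegral_eq_orbitalIntegral_of_split c N J hc hJ w hw hJw ν mG hcanG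
    (ν.map (localSplitEquiv c J hc hJ w hw hJw)) rfl γ₀ hreg (p : GL (Fin N) (w.1.adicCompletion E)) q hq φ
  have hsep : (((p : GL (Fin N) (w.1.adicCompletion E)) : Matrix (Fin N) (Fin N) (w.1.adicCompletion E)).charpoly).Separable := by
    have h := (isRegularElt_conj_iff q ((localSplitEquiv c J hc hJ w hw hJw) γ₀)).2 (isRegularElt_localSplitEquiv_of_isRegularElt c w J hc hw hJ hJw γ₀ hreg)
    rw [hq] at h
    exact h
  have hO : IsClosed {g : GL (Fin N) (w.1.adicCompletion E) | ∃ y : GL (Fin N) (w.1.adicCompletion E), y * (p : GL (Fin N) (w.1.adicCompletion E)) * y⁻¹ = g} :=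
    Literature.LinearAlgebra.Matrix.isClosed_conjClass_of_charpoly_separable_field _ hsep
  have hφ'c : Continuous (φ ∘ ⇑(localSplitEquiv c J hc hJ w hw hJw).symm) := hφc.comp (localSplitEquiv c J hc hJ w hw hJw).symm.continuous
  have hφ's : HasCompactSupport (φ ∘ ⇑(localSplitEquiv c J hc hJ w hw hJw).symm) := hφs.comp_homeomorph (localSplitEquiv c J hc hJ w hw hJw).symm.toHomeomorph
  rw [hA]
  exact hB p hpM hO hTM hp ρG hρG1 ρ hρ (φ ∘ ⇑(localSplitEquiv c J hc hJ w hw hJw).symm) hφ'c hφ's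

end Split

end Literature.NumberTheory.Rogawski1990

end
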